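import Summits.Ventures.HodgeRepro2.T5SU11KernelDifferenceRegularity
import Summits.Ventures.HodgeRepro2.T5SU11WeightedSpaceGroundStateClass
import Summits.Ventures.HodgeRepro2.T5SU11ResolventDerivativeGroundState
import Summits.Ventures.HodgeRepro2.T5SU11ResolventDerivativeMu

/-!
# The derivative of the kernel in the spectral parameter: `∂_μ K_μ(t, s) = (K_μ ∘ K_μ)(t, s)`

The kernel source `k_s = K_{λ₂}(·, s)` is a source of the class at the rate `λ₂ > 1` (row 5xx), hence lies in `W_1`
(row 574), and `G^I_λ k_s(t) = (K_λ(t, s) − K_{λ₂}(t, s))/(μ − μ₂)` (row 5xx's `greenSolI_kernel_eq`, the resolvent identity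
of the kernel). Row 561's continuity of `λ ↦ G^I_λ k_s(t)` on `W_1` then gives:

* `kernel_source_mem_weighted_one` — `|K_{λ₂}(r, s)| ≤ D Ξ(r)` on `(0, ∞)`;
* `greenSolI_kernel_source_eq_integral` — `G^I_{λ₂} k_s(t) = ∫_r K_{λ₂}(t, r) K_{λ₂}(r, s) sinh 2r dr = (K_{λ₂} ∘ K_{λ₂})(t, s)`;
* `hasDerivAt_sphGreenKernel_lam`, `deriv_sphGreenKernel_lam`, `continuousAt_sphGreenKernel_lam` — **`λ ↦ K_λ(t, s)` is
  differentiable at every `λ₂ > 1` with derivative `(2λ₂ − 2) · (K_{λ₂} ∘ K_{λ₂})(t, s)`**;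
* `hasDerivAt_sphGreenKernel_mu` — **`∂_μ K_μ(t, s) = (K_μ ∘ K_μ)(t, s)`** in the variable `μ`, `λ = 1 + √(μ + 1)`: the
  kernel's resolvent identity `K_λ − K_{λ₂} = (μ − μ₂) K_λ ∘ K_{λ₂}` (row 511) differentiated.

Nothing is claimed about (N).

Blind lane: Mathlib + the HodgeRepro2 prefix only; no sorry; axioms ⊆ {propext, Classical.choice,
Quot.sound}.
-/

namespace Summit.Ventures.HodgeRepro2.T5SU11KernelDerivative

open Filter Topology MeasureTheory
open Set (Ioi Ioc)
open T5SU11Cartan T5SU11SphericalFunction T5SU11SphericalDecay T5SU11RadialGreenKernel T5SU11RadialGreenImproper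
  T5SU11RadialGreenImproperDecaySource T5SU11ResolventKernelComposition T5SU11KernelDifferenceRegularity
  T5SU11WeightedSpaceGroundStateClass T5SU11ResolventDerivativeGroundState T5SU11ResolventDerivativeMu

section measure

variable [MeasurableSpace Circle] [BorelSpace Circle]

variable {lam₂ : ℝ} (hlam₂ : 1 < lam₂) {s : ℝ} (hs : 0 < s)

include hlam₂ hs in
/-- **The kernel source `r ↦ K_{λ₂}(r, s)` lies in `W_1`**: `|K_{λ₂}(r, s)| ≤ D Ξ(r)` on `(0, ∞)`. -/
theorem kernel_source_mem_weighted_one :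
    ∃ D : ℝ, 0 ≤ D ∧ ∀ r, 0 < r → |sphGreenKernel lam₂ r s| ≤ D * sph 1 (hyp r) := by
  obtain ⟨M, _, hM⟩ := kernel_source_bounded hlam₂ hs
  obtain ⟨C, s₀, hC⟩ := kernel_source_decay hlam₂ hs
  exact exists_le_mul_sph_one_of_class (kernel_source_continuousOn hlam₂ hs) hM (ε := lam₂) hlam₂.le hC

include hlam₂ hs in
/-- **`G^I_{λ₂} K_{λ₂}(·, s)(t) = ∫_r K_{λ₂}(t, r) K_{λ₂}(r, s) sinh 2r dr`** — the composed kernel (`t > 0`). -/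
theorem greenSolI_kernel_source_eq_integral {t : ℝ} (ht : 0 < t) :
    greenSolI (fun t => sph lam₂ (hyp t)) (sphDecay lam₂) (fun r => sphGreenKernel lam₂ r s) t
      = ∫ r in Ioi 0, sphGreenKernel lam₂ t r * sphGreenKernel lam₂ r s * Real.sinh (2 * r) := by
  obtain ⟨M, hM0, hM⟩ := kernel_source_bounded hlam₂ hs
  obtain ⟨C, s₀, hC⟩ := kernel_source_decay hlam₂ hs
  have hg := kernel_source_continuousOn hlam₂ hs
  have hB := integrableOn_sph_mul_mul_sinh_Ioc hg hM hM0 lam₂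
  have hA := integrableOn_sphDecay_mul_mul_sinh hlam₂ hg hM hM0 (by linarith : 2 - lam₂ < lam₂) hC
  rw [greenSolI_eq_integral_kernel hB hA ht]
  rfl

include hlam₂ hs in
/-- **THE DERIVATIVE OF THE KERNEL IN THE SPECTRAL PARAMETER**: `λ ↦ K_λ(t, s)` has the derivative
`(2λ₂ − 2) · ∫_r K_{λ₂}(t, r) K_{λ₂}(r, s) sinh 2r dr` at every `λ₂ > 1` (`t > 0`). -/
theorem hasDerivAt_sphGreenKernel_lam {t : ℝ} (ht : 0 < t) :
    HasDerivAt (fun l => sphGreenKernel l t s)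
      ((2 * lam₂ - 2) * ∫ r in Ioi 0, sphGreenKernel lam₂ t r * sphGreenKernel lam₂ r s * Real.sinh (2 * r)) lam₂ := by
  rw [hasDerivAt_iff_tendsto_slope]
  obtain ⟨D, _, hD⟩ := kernel_source_mem_weighted_one hlam₂ hs
  have hg := kernel_source_continuousOn hlam₂ hs
  -- `l ↦ G^I_l k_s(t)` is continuous at `λ₂` (row 561 on `W_1`)
  have hlim : Tendsto (fun l => (l + lam₂ - 2) * greenSolI (fun t => sph l (hyp t)) (sphDecay l)
      (fun r => sphGreenKernel lam₂ r s) t) (𝓝 lam₂)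
      (𝓝 ((2 * lam₂ - 2) * greenSolI (fun t => sph lam₂ (hyp t)) (sphDecay lam₂) (fun r => sphGreenKernel lam₂ r s) t)) := by
    have h1 : Tendsto (fun l : ℝ => l + lam₂ - 2) (𝓝 lam₂) (𝓝 (lam₂ + lam₂ - 2)) :=
      ((continuous_id.add continuous_const).sub continuous_const).tendsto lam₂
    have h2 := tendsto_greenSolI_lam hlam₂ hg hD ht
    have h12 := h1.mul h2
    rwa [show lam₂ + lam₂ - 2 = 2 * lam₂ - 2 by ring] at h12
  rw [← greenSolI_kernel_source_eq_integral hlam₂ hs ht]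
  refine (tendsto_nhdsWithin_of_tendsto_nhds hlim).congr' ?_
  -- on `𝓝[≠] λ₂`, eventually `l > 1`, and the slope is `(l + λ₂ − 2) G^I_l k_s(t)` by the kernel's resolvent identity
  have hev : ∀ᶠ l in 𝓝[≠] lam₂, 1 < l := eventually_nhdsWithin_of_eventually_nhds (eventually_gt_nhds hlam₂)
  filter_upwards [hev, self_mem_nhdsWithin] with l hl hne
  have hne' : l ≠ lam₂ := Set.mem_compl_singleton_iff.mp hne
  have hne'' : l - lam₂ ≠ 0 := sub_ne_zero.mpr hne'
  have h3 : l + lam₂ - 2 ≠ 0 := (by linarith : (0 : ℝ) < l + lam₂ - 2).ne'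
  simp only [slope_def_field]
  have hK := greenSolI_kernel_eq hl hlam₂ hs hne' ht
  rw [hK]
  have e : l * (l - 2) - lam₂ * (lam₂ - 2) = (l - lam₂) * (l + lam₂ - 2) := by ring
  rw [e]
  field_simp

include hlam₂ hs in
/-- **`deriv (λ ↦ K_λ(t, s)) λ₂ = (2λ₂ − 2) · (K_{λ₂} ∘ K_{λ₂})(t, s)`**. -/
theorem deriv_sphGreenKernel_lam {t : ℝ} (ht : 0 < t) :
    deriv (fun l => sphGreenKernel l t s) lam₂
      = (2 * lam₂ - 2) * ∫ r in Ioi 0, sphGreenKernel lam₂ t r * sphGreenKernel lam₂ r s * Real.sinh (2 * r) :=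
  (hasDerivAt_sphGreenKernel_lam hlam₂ hs ht).deriv

include hlam₂ hs in
/-- **The kernel is continuous in the spectral parameter** at every `λ₂ > 1`. -/
theorem continuousAt_sphGreenKernel_lam {t : ℝ} (ht : 0 < t) :
    ContinuousAt (fun l => sphGreenKernel l t s) lam₂ :=
  (hasDerivAt_sphGreenKernel_lam hlam₂ hs ht).continuousAt

include hlam₂ hs in
/-- **`∂_μ K_μ(t, s) = (K_μ ∘ K_μ)(t, s)`**: `μ ↦ K_{1+√(μ+1)}(t, s)` has the derivative
`∫_r K_{λ₂}(t, r) K_{λ₂}(r, s) sinh 2r dr` at `μ₂ = λ₂(λ₂ − 2)`. -/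
theorem hasDerivAt_sphGreenKernel_mu {t : ℝ} (ht : 0 < t) :
    HasDerivAt (fun μ => sphGreenKernel (1 + Real.sqrt (μ + 1)) t s)
      (∫ r in Ioi 0, sphGreenKernel lam₂ t r * sphGreenKernel lam₂ r s * Real.sinh (2 * r)) (lam₂ * (lam₂ - 2)) := by
  have hμ : -1 < lam₂ * (lam₂ - 2) := by nlinarith
  have hinner := hasDerivAt_one_add_sqrt hμ
  have houter := hasDerivAt_sphGreenKernel_lam hlam₂ hs ht
  rw [← one_add_sqrt_eq hlam₂] at houter
  have hcomp := houter.comp (lam₂ * (lam₂ - 2)) hinner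
  rw [one_add_sqrt_eq hlam₂] at hcomp
  refine hcomp.congr_deriv ?_
  have hsq : lam₂ * (lam₂ - 2) + 1 = (lam₂ - 1) ^ 2 := by ring
  have hsqrt : Real.sqrt (lam₂ * (lam₂ - 2) + 1) = lam₂ - 1 := by
    rw [hsq, Real.sqrt_sq (by linarith)]
  have h2 : 2 * (lam₂ - 1) ≠ 0 := by
    have : lam₂ - 1 ≠ 0 := by linarith
    positivity
  rw [show (2 * lam₂ - 2) = 2 * (lam₂ - 1) by ring, hsqrt, mul_one_div, mul_div_cancel_left₀ _ h2]

end measure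

end Summit.Ventures.HodgeRepro2.T5SU11KernelDerivative
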